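import Summits.ResolutionOfSingularities.ResolutionOfSingularities.Theorems.FrobeniusClosingSteerCompletionFrobeniusClosed
import Literature.AlgebraicGeometry.Resolution.RegularLocalOrder
import Literature.AlgebraicGeometry.Resolution.RegularLocalRingsNormal
import Mathlib.Algebra.CharP.Lemmas
import HarnessLib

/-!
# Crux `Steer` (stmt-ResolutionOfSingularities-16345), chain W4.1, (Σ) `PointStepsRecurTwoN` support, brick **(Σ-a)**:
# `𝔪`-ADIC LIMITS OF `p`-TH POWERS in a regular local ring — the roots are Cauchy, an excellent regular local ring is
# closed under such limits, and strips raise the cleaned order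

OURS (campaign `res-hironaka`, rung L ★L-G4, slot W4.1; seat res-L0-w41-stub-4 g6 on res-L0-w41-plan-1 RULING 112b
2026-08-27T11:44:47Z «(Σ-a) SQUARE-LIMIT BRICK», imported by the prover of (Σ) res-type-028 (RULING 111a; 028's
PATH-ANNOUNCE governs the interface); replaces the role of no printed item; NOT a statement of the manuscript under review
[claim: Hironaka2017, status: under-review]; AI-produced, weaker than expert review). Theses-free and definition-free.

* **`exists_pow_eq_of_forall_exists_sub_pow_mem_pow`** (RULING 112b verbatim) — an EXCELLENT regular local ring `S` of
  characteristic `p` is closed under `𝔪`-adic limits of `p`-th powers: `(∀ n, ∃ g, f − g^p ∈ 𝔪ⁿ) ⇒ ∃ c, c^p = f`.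
  Proof: the roots are `𝔪`-adically Cauchy (below) and the tree's K(1)-class fact
  `CompletionFrobeniusClosed.exists_pow_eq_of_adicCauchy_of_isExcellentRing` (regular ⇒ normal domain:
  tree `isDomain_of_isRegularLocalRing`, `isIntegrallyClosed_of_isRegularLocalRing`).
* `mem_pow_of_pow_mem_pow_mul` — in a regular local ring, `h ^ p ∈ 𝔪^(p·n) ⇒ h ∈ 𝔪^n` (`ord` is a valuation; tree
  `Ideal.le_pow_of_pow_le_pow_mul`).
* `exists_adicCauchy_of_forall_exists_sub_pow_mem` — **the `p`-th roots of an `𝔪`-adic limit of `p`-th powers are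
  `𝔪`-adically Cauchy**: if `char R = p` and for every `n` some `g` has `f − g^p ∈ 𝔪ⁿ`, then there is `a : ℕ → R` with
  `a n − a (n+1) ∈ 𝔪ⁿ` and `(a n)^p − f ∈ 𝔪ⁿ` — exactly the input of the K(1)-class Frobenius-closedness facts
  `CompletionFrobeniusClosed.exists_pow_eq_of_adicCauchy[_of_isGRing|_of_isExcellentRing]` (`(gₙ − gₘ)^p = gₙ^p − gₘ^p`).
* `sub_add_mul_pow_mem_pow_add` — **one strip raises the cleaned order by `p`**: if `f = x^p · f' + g^p` with
  `x ∈ 𝔪` and `f' − h^p ∈ 𝔪^m`, then `f − (g + x·h)^p ∈ 𝔪^(m + p)` (`(g + xh)^p = g^p + x^p h^p`); any commutative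
  ring of characteristic `p`.
* `forall_exists_sub_pow_mem_of_chain` — along an infinite chain of strips `f i = (x i)^p · f (i+1) + (g i)^p` in ONE
  ring (`x i ∈ 𝔪`), every `f i` is an `𝔪`-adic limit of `p`-th powers.

(«principal height-one centre ⇒ the local blowing up returns the member» is ALREADY in the tree:
`StrippedThreadLemmas.eq_locAtCentre_of_divisorStep` / `NoSingularCarrier.eq_of_isLocalBlowupAlong_span_singleton` — not
restated here.)

[cite: ZariskiSamuel1960, Ch. VIII §1 Thm. 1] [cite: Matsumura1987, §32 p. 260] [folklore]
bears_on: LADDER-RESOLUTION L ★L-G4 W4.1 (crux `Steer`, (Σ) / hΘ).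
-/

noncomputable section

-- `Summit.<S>.<S>.…` duplicates the summit name by design (single-problem summit).
set_option linter.dupNamespace false

open IsLocalRing

namespace Summit.ResolutionOfSingularities.ResolutionOfSingularities.Theorems.SwitchingDichotomy.PowLimit

open Literature.AlgebraicGeometry.Resolution

universe u

/-- In a regular local ring, `h ^ p ∈ 𝔪^(p·n)` forces `h ∈ 𝔪ⁿ` (for `p ≥ 1`): the order is a valuation.
[cite: ZariskiSamuel1960, Ch. VIII §1 Thm. 1] [folklore] -/
theorem mem_pow_of_pow_mem_pow_mul {R : Type u} [CommRing R] [IsRegularLocalRing R] {p : ℕ} (hp : 0 < p)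
    {h : R} {n : ℕ} (hh : h ^ p ∈ maximalIdeal R ^ (p * n)) : h ∈ maximalIdeal R ^ n := by
  have hle : Ideal.span {h} ^ p ≤ maximalIdeal R ^ (p * n) := by
    rw [Ideal.span_singleton_pow, Ideal.span_singleton_le_iff_mem]
    exact hh
  exact Ideal.le_pow_of_pow_le_pow_mul hp hle (Ideal.mem_span_singleton_self h)

/-- **The `p`-th roots of an `𝔪`-adic limit of `p`-th powers are Cauchy** (regular local ring of characteristic `p`):
if for every `n` some `g` has `f − g ^ p ∈ 𝔪ⁿ`, then there is an `𝔪`-adic Cauchy sequence `a` with `(a n)^p → f`,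
in the shape consumed by `CompletionFrobeniusClosed.exists_pow_eq_of_adicCauchy`. [folklore] -/
theorem exists_adicCauchy_of_forall_exists_sub_pow_mem {R : Type u} [CommRing R] [IsRegularLocalRing R] (p : ℕ)
    [Fact p.Prime] [CharP R p] (f : R) (hf : ∀ n : ℕ, ∃ g : R, f - g ^ p ∈ maximalIdeal R ^ n) :
    ∃ a : ℕ → R, (∀ n, a n - a (n + 1) ∈ maximalIdeal R ^ n) ∧ (∀ n, a n ^ p - f ∈ maximalIdeal R ^ n) := by
  have hp : 0 < p := (Fact.out : p.Prime).pos
  choose g hg using fun n => hf (p * n)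
  have hg' : ∀ n, g n ^ p - f ∈ maximalIdeal R ^ (p * n) := fun n => by
    rw [← neg_sub]; exact neg_mem (hg n)
  refine ⟨g, fun n => ?_, fun n => Ideal.pow_le_pow_right (Nat.le_mul_of_pos_left n hp) (hg' n)⟩
  apply mem_pow_of_pow_mem_pow_mul hp
  rw [sub_pow_char, show g n ^ p - g (n + 1) ^ p = (g n ^ p - f) - (g (n + 1) ^ p - f) by ring]
  exact sub_mem (hg' n) (Ideal.pow_le_pow_right (by nlinarith) (hg' (n + 1)))

/-- **(Σ-a) An excellent regular local ring of characteristic `p` is closed under `𝔪`-adic limits of `p`-th powers**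
(res-L0-w41-plan-1 RULING 112b, verbatim interface): if for every `n` some `g` has `f − g ^ p ∈ 𝔪ⁿ`, then `f = c ^ p`
for some `c ∈ S`. (Roots Cauchy by `exists_adicCauchy_of_forall_exists_sub_pow_mem`; then the tree's K(1)-class fact
`CompletionFrobeniusClosed.exists_pow_eq_of_adicCauchy_of_isExcellentRing`, a regular local ring being a normal domain.)
For `p = 2` this is the «SQUARE-LIMIT BRICK» of (Σ): `ν*(f) = ∞ ⇒ f ∈ S²`. [cite: Matsumura1987, §32 p. 260] [folklore] -/
theorem exists_pow_eq_of_forall_exists_sub_pow_mem_pow {S : Type u} [CommRing S] (p : ℕ) [Fact p.Prime]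
    [IsRegularLocalRing S] [CharP S p] (hS : IsExcellentRing S) (f : S)
    (h : ∀ n : ℕ, ∃ g : S, f - g ^ p ∈ maximalIdeal S ^ n) : ∃ c : S, c ^ p = f := by
  haveI : IsDomain S := isDomain_of_isRegularLocalRing S
  haveI : IsIntegrallyClosed S := isIntegrallyClosed_of_isRegularLocalRing S
  obtain ⟨a, ha, hfa⟩ := exists_adicCauchy_of_forall_exists_sub_pow_mem p f h
  exact CompletionFrobeniusClosed.exists_pow_eq_of_adicCauchy_of_isExcellentRing hS p f a ha hfa

/-- **One strip raises the cleaned order by `p`** (any commutative ring of characteristic `p`): from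
`f = x ^ p * f' + g ^ p`, `x ∈ 𝔪` and `f' − h ^ p ∈ 𝔪 ^ m` get `f − (g + x * h) ^ p ∈ 𝔪 ^ (m + p)`. [folklore] -/
theorem sub_add_mul_pow_mem_pow_add {R : Type u} [CommRing R] (p : ℕ) [Fact p.Prime] [CharP R p] (I : Ideal R)
    {f f' g x h : R} (hf : f = x ^ p * f' + g ^ p) (hx : x ∈ I) {m : ℕ} (hh : f' - h ^ p ∈ I ^ m) :
    f - (g + x * h) ^ p ∈ I ^ (m + p) := by
  have key : f - (g + x * h) ^ p = (f' - h ^ p) * x ^ p := by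
    rw [add_pow_char, mul_pow, hf]; ring
  rw [key, pow_add]
  exact Ideal.mul_mem_mul hh (Ideal.pow_mem_pow hx p)

/-- **Along an infinite chain of strips every member is an `𝔪`-adic limit of `p`-th powers**: if
`f i = (x i)^p * f (i+1) + (g i)^p` with `x i ∈ I` for all `i` (one ring, characteristic `p`), then for every `i`
and `n` some `G` has `f i − G ^ p ∈ I ^ n` (indeed `∈ I^(p·n)`). [folklore] -/
theorem forall_exists_sub_pow_mem_of_chain {R : Type u} [CommRing R] (p : ℕ) [Fact p.Prime] [CharP R p]
    (I : Ideal R) (f g x : ℕ → R) (hx : ∀ i, x i ∈ I) (hf : ∀ i, f i = x i ^ p * f (i + 1) + g i ^ p)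
    (i n : ℕ) : ∃ G : R, f i - G ^ p ∈ I ^ n := by
  -- by induction on `n`, simultaneously for all `i`
  have hp : 0 < p := (Fact.out : p.Prime).pos
  suffices h : ∀ n i, ∃ G : R, f i - G ^ p ∈ I ^ (n * p) by
    obtain ⟨G, hG⟩ := h n i
    exact ⟨G, Ideal.pow_le_pow_right (Nat.le_mul_of_pos_right n hp) hG⟩
  intro n
  induction n with
  | zero => intro i; exact ⟨0, by rw [zero_mul, pow_zero, Ideal.one_eq_top]; trivial⟩
  | succ n ih =>
    intro i
    obtain ⟨H, hH⟩ := ih (i + 1)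
    refine ⟨g i + x i * H, ?_⟩
    rw [Nat.succ_mul]
    exact sub_add_mul_pow_mem_pow_add p I (hf i) (hx i) hH

end Summit.ResolutionOfSingularities.ResolutionOfSingularities.Theorems.SwitchingDichotomy.PowLimit

end
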